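import Summits.HodgeConjecture.CorCM.WeilLinePairForm
import Literature.AlgebraicGeometry.HodgeTheory.AlgebraicClassesExteriorProduct
import Literature.AlgebraicGeometry.Motives.AbelianVarietyProduct
import HarnessLib

/-!
# COR-CM (cell `pub-hodgecm2`): `K`-Weil-line classes of a product of two CONJUGATE PAIRS of CM-typed
# realisations are algebraic (the pair case (P) of the four-slot products)

HONEST FRAMING (cell pub-hodgecm2 / COR-CM, binder prover p2; count-neutral layer L0 (P) of lit-andre-3's
sized ask A1, second half): the EASY case of the algebraicity of `K`-Weil-line classes on four-slot products
of CM abelian varieties — no period theorem, no Markman; inputs are the pair case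
(`CorCM/WeilLinePairForm.lean`, Lefschetz `(1,1)`) and exterior products of algebraic classes
(`HodgeTheory.cupProduct_map_fst_map_snd_mem_algebraicClasses`, PROVED in the tree without moving lemma).

Setting: a number field `K`; four slots `A j` (`j : Fin 4`) with `𝓞_K`-actions `act j` realising CM types
`Ψ j` (`ComplexMultiplication.IsCMTypeRealisation`), forming two CONJUGATE PAIRS: `Ψ 1 = Ψ̄ 0` and
`Ψ 3 = Ψ̄ 2` (`CMTypeOps.bar`) — alternative (P) of `CyclicSextic.sumTwo_pattern` (`CorCM/CyclicSexticFaces.lean`)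
for the admissible slot families of André's product form at `p = 2`, in the normalised position.

* `monomial_eq_map_prodLift` — the four-slot monomial `μ_σ` is the pull-back along the homomorphism
  `(q₀₁, q₂₃) : ⨁ A → (A 0 ⊞ A 1) × (A 2 ⊞ A 3)` of the exterior product of the two pair monomials;
* `monomial_mem_algebraicClasses_of_pairs` — hence `μ_σ` is algebraic (`map_mem_algebraicClasses_of_abelianVariety`);
* `weilLineClasses_le_algebraicClasses_of_pairs` — **`weilLineClasses A act 4 ≤ algebraicClasses (⨁ A).X 2`**
  (`WeilLineMonomial.weilLineClasses_eq_iSup_span_monomial`), and the consumer form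
  `mem_algebraicClasses_of_mem_weilLineClasses_of_pairs` (hypothesis `hW` of
  `HodgeTheory.mem_algebraicClasses_cmTypedProduct_of_andre1992` at `p = 2`, case (P); rationality and Hodge
  type of the class are not even needed).

References: [Deligne1982HodgeCycles] LNM 900 (1982), §4 (4.4), endnote M.12; [VoisinHodgeI2002] Thm. 11.30;
[VoisinHodgeII2003] Prop. 9.20 (exterior products of cycle classes).
-/

noncomputable section

namespace Summit.HodgeConjecture.CorCM.WeilLineMonomial

open CategoryTheory CategoryTheory.Limits NumberField MonoidalCategory
open Literature.AlgebraicTopology.SingularHomology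
open Literature.AlgebraicGeometry Literature.AlgebraicGeometry.Motives Literature.AlgebraicGeometry.HodgeTheory
open Literature.AlgebraicGeometry.ComplexMultiplication
open Literature.NumberTheory.ComplexMultiplication (CMTypeOps.bar)
open Literature.NumberTheory.Automorphic.PicardCM (eigenline)
open Summit.HodgeConjecture.CorCM.AndreProductForm
open Summit.HodgeConjecture.HodgeConjecture.Theorems.HodgeAbelianVarieties.CMPivotAndre
  (complexBetti_map_map_one_apply)

variable {K : Type} [Field K] [NumberField K]

/-! ## Two conjugate pairs: the four-slot monomials and Weil-line classes are algebraic -/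

section FourSlots

variable {A : Fin 4 → AbelianVariety ℂ} {act : ∀ j, 𝓞 K →+* End (A j)}
  {θ : ∀ j, K →+* Module.End ℂ (complexBetti (A j).X 1)} {Ψ : Fin 4 → CMType K}
  {v : ∀ j, Module.Basis (K →+* ℂ) ℂ (complexBetti (A j).X 1)}

/-- `m₄(w) = (w₀ ∪ w₁) ∪ (w₂ ∪ w₃)` for degree-one classes (associativity and unit of the cup product;
the tree's `CorCM.Model.cupPowOne_four'`, restated to keep this file's import cone small). [folklore] -/
private theorem cupPowOne_four {Y : Type} [TopologicalSpace Y] (w : Fin 4 → singularCohomology ℂ ℂ Y 1) :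
    cupPowOne ℂ Y 4 w =
      cupProduct (rfl : 2 + 2 = 4) (cupProduct (Nat.add_comm 1 1) (w 0) (w 1))
        (cupProduct (Nat.add_comm 1 1) (w 2) (w 3)) := by
  rw [cupPowOne_succ, cupPowOne_succ, cupPowOne_succ, cupPowOne_one,
    cupProduct_assoc (rfl : 1 + 1 = 2) (rfl : 1 + 2 = 3) (rfl : 2 + 2 = 4) (rfl : 1 + 3 = 4)]
  rfl

/-- The slot maps of the two pairs. [folklore] -/
def pairSlots (t : Fin 2) : Fin 2 → Fin 4 := fun m => ⟨2 * t.1 + m.1, by omega⟩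

/-- The pull-back along the pair projection `q_t : ⨁ A → A (2t) ⊞ A (2t+1)` of the pair's eigen-line basis
vector `(m, σ)` is the eigen-line basis vector `(2t+m, σ)` of `⨁ A`. [folklore] -/
theorem map_multiDiagonal_biprodBasis (t : Fin 2) (m : Fin 2) (σ : K →+* ℂ) :
    complexBetti.map (multiDiagonal A (pairSlots t)).hom.hom.hom 1
        (biprodBasis (fun m => A (pairSlots t m)) (fun m => v (pairSlots t m)) (m, σ)) =
      biprodBasis A v (pairSlots t m, σ) := by
  rw [biprodBasis_apply, biprodBasis_apply]
  dsimp only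
  rw [complexBetti_map_map_one_apply, multiDiagonal_π]

/-- **The four-slot monomial is the pull-back of the exterior product of the two pair monomials** along
`(q₀₁, q₂₃) : ⨁ A → (A 0 ⊞ A 1) × (A 2 ⊞ A 3)` (pull-back is a ring homomorphism, `(q₀₁,q₂₃) ≫ fst = q₀₁`,
`q₀₁ ≫ π_m = π_{m}`, and `m₄(w) = (w₀ ∪ w₁) ∪ (w₂ ∪ w₃)`). [folklore] -/
theorem monomial_eq_map_prodLift (σ : K →+* ℂ) :
    monomial A v σ = complexBetti.map
      (AbelianVariety.prodLift (multiDiagonal A (pairSlots 0)) (multiDiagonal A (pairSlots 1))).hom.hom.hom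
      (2 * (1 + 1))
      (cupProduct (two_mul_add_two_mul 1 1)
        (complexBetti.map (CartesianMonoidalCategory.fst (⨁ fun m => A (pairSlots 0 m)).X
          (⨁ fun m => A (pairSlots 1 m)).X) (2 * 1)
          (monomial (fun m => A (pairSlots 0 m)) (fun m => v (pairSlots 0 m)) σ))
        (complexBetti.map (CartesianMonoidalCategory.snd (⨁ fun m => A (pairSlots 0 m)).X
          (⨁ fun m => A (pairSlots 1 m)).X) (2 * 1)
          (monomial (fun m => A (pairSlots 1 m)) (fun m => v (pairSlots 1 m)) σ))) := by
  set P₀ := ⨁ fun m => A (pairSlots 0 m)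
  set P₁ := ⨁ fun m => A (pairSlots 1 m)
  set h := AbelianVariety.prodLift (multiDiagonal A (pairSlots 0)) (multiDiagonal A (pairSlots 1))
  -- `h ≫ fst = q₀₁`, `h ≫ snd = q₂₃` on underlying schemes
  have hfst : h.hom.hom.hom ≫ CartesianMonoidalCategory.fst P₀.X P₁.X =
      (multiDiagonal A (pairSlots 0)).hom.hom.hom := by
    change (h ≫ AbelianVariety.fst P₀ P₁).hom.hom.hom = _
    rw [AbelianVariety.prodLift_fst]
  have hsnd : h.hom.hom.hom ≫ CartesianMonoidalCategory.snd P₀.X P₁.X =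
      (multiDiagonal A (pairSlots 1)).hom.hom.hom := by
    change (h ≫ AbelianVariety.snd P₀ P₁).hom.hom.hom = _
    rw [AbelianVariety.prodLift_snd]
  -- pull-back is multiplicative and functorial
  have e1 : ∀ (t : Fin 2) (pr : P₀.X ⊗ P₁.X ⟶ (⨁ fun m => A (pairSlots t m)).X)
      (hpr : h.hom.hom.hom ≫ pr = (multiDiagonal A (pairSlots t)).hom.hom.hom),
      complexBetti.map h.hom.hom.hom (2 * 1) (complexBetti.map pr (2 * 1)
        (monomial (fun m => A (pairSlots t m)) (fun m => v (pairSlots t m)) σ)) =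
      cupProduct (Nat.add_comm 1 1) (biprodBasis A v (pairSlots t 0, σ)) (biprodBasis A v (pairSlots t 1, σ)) := by
    intro t pr hpr
    have step : complexBetti.map h.hom.hom.hom (2 * 1) (complexBetti.map pr (2 * 1)
        (monomial (fun m => A (pairSlots t m)) (fun m => v (pairSlots t m)) σ)) =
        complexBetti.map (multiDiagonal A (pairSlots t)).hom.hom.hom 2
          (monomial (fun m => A (pairSlots t m)) (fun m => v (pairSlots t m)) σ) := by
      rw [← hpr, complexBetti.map_comp]
      rfl
    rw [step, monomial_two]
    change singularCohomology.map ℂ ℂ _ 2 (cupProduct (Nat.add_comm 1 1) _ _) = _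
    rw [cupProduct_map]
    change cupProduct (Nat.add_comm 1 1)
      (complexBetti.map (multiDiagonal A (pairSlots t)).hom.hom.hom 1 (biprodBasis _ _ (0, σ)))
      (complexBetti.map (multiDiagonal A (pairSlots t)).hom.hom.hom 1 (biprodBasis _ _ (1, σ))) = _
    rw [map_multiDiagonal_biprodBasis, map_multiDiagonal_biprodBasis]
  change _ = singularCohomology.map ℂ ℂ _ (2 * (1 + 1)) (cupProduct (two_mul_add_two_mul 1 1) _ _)
  rw [cupProduct_map]
  change _ = cupProduct (two_mul_add_two_mul 1 1)
    (complexBetti.map h.hom.hom.hom (2 * 1) (complexBetti.map (CartesianMonoidalCategory.fst P₀.X P₁.X) (2 * 1)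
      (monomial (fun m => A (pairSlots 0 m)) (fun m => v (pairSlots 0 m)) σ)))
    (complexBetti.map h.hom.hom.hom (2 * 1) (complexBetti.map (CartesianMonoidalCategory.snd P₀.X P₁.X) (2 * 1)
      (monomial (fun m => A (pairSlots 1 m)) (fun m => v (pairSlots 1 m)) σ)))
  rw [e1 0 _ hfst, e1 1 _ hsnd, monomial_def, cupPowOne_four]
  rfl

/-- **The four-slot monomials of two conjugate pairs are algebraic**: exterior product of the two algebraic
pair monomials (`cupProduct_map_fst_map_snd_mem_algebraicClasses`), pulled back along the homomorphism
`(q₀₁, q₂₃)` of abelian varieties (`map_mem_algebraicClasses_of_abelianVariety`).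
[cite: VoisinHodgeII2003, Prop. 9.20] [cite: VoisinHodgeI2002, Thm. 11.30] -/
theorem monomial_mem_algebraicClasses_of_pairs (hA : ∀ j, IsCMTypeRealisation (Ψ j) (A j) (act j) (θ j))
    (hv : ∀ j σ, v j σ ∈ eigenline (θ j) σ) (h01 : Ψ 1 = CMTypeOps.bar (Ψ 0))
    (h23 : Ψ 3 = CMTypeOps.bar (Ψ 2)) (σ : K →+* ℂ) :
    monomial A v σ ∈ algebraicClasses (⨁ A).X 2 := by
  have hP₀ : IsSmoothProjective (⨁ fun m => A (pairSlots 0 m)).dim (⨁ fun m => A (pairSlots 0 m)).X :=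
    AbelianVariety.isSmoothProjective_holds
  have hP₁ : IsSmoothProjective (⨁ fun m => A (pairSlots 1 m)).dim (⨁ fun m => A (pairSlots 1 m)).X :=
    AbelianVariety.isSmoothProjective_holds
  have hB : IsSmoothProjective (⨁ A).dim (⨁ A).X := AbelianVariety.isSmoothProjective_holds
  have m₀ : monomial (fun m => A (pairSlots 0 m)) (fun m => v (pairSlots 0 m)) σ ∈
      algebraicClasses (⨁ fun m => A (pairSlots 0 m)).X 1 :=
    pairMonomial_mem_algebraicClasses (Ψ := fun m => Ψ (pairSlots 0 m)) (act := fun m => act (pairSlots 0 m))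
      (θ := fun m => θ (pairSlots 0 m)) (fun m => hA _) (fun m σ => hv _ σ) h01 σ
  have m₁ : monomial (fun m => A (pairSlots 1 m)) (fun m => v (pairSlots 1 m)) σ ∈
      algebraicClasses (⨁ fun m => A (pairSlots 1 m)).X 1 :=
    pairMonomial_mem_algebraicClasses (Ψ := fun m => Ψ (pairSlots 1 m)) (act := fun m => act (pairSlots 1 m))
      (θ := fun m => θ (pairSlots 1 m)) (fun m => hA _) (fun m σ => hv _ σ) h23 σ
  have hx := cupProduct_map_fst_map_snd_mem_algebraicClasses hP₀ hP₁ m₀ m₁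
  have hy := map_mem_algebraicClasses_of_abelianVariety hB
    ((⨁ fun m => A (pairSlots 0 m)).prod (⨁ fun m => A (pairSlots 1 m)))
    (AbelianVariety.prodLift (multiDiagonal A (pairSlots 0)) (multiDiagonal A (pairSlots 1))).hom.hom.hom hx
  rw [← monomial_eq_map_prodLift] at hy
  exact hy

/-- **Pair case (P) of the four-slot Weil lines: for two conjugate pairs of CM-typed realisations, every
`K`-Weil-line class of `⨁ A` is algebraic** (`weilLineClasses A act 4 = ⨆_s ℂ μ_s` and each `μ_s` is
algebraic). No period theorem, no Markman: Lefschetz `(1,1)` and exterior products only.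
[cite: Deligne1982HodgeCycles, §4 (4.4) and endnote M.12] [cite: VoisinHodgeI2002, Thm. 11.30]
[cite: VoisinHodgeII2003, Prop. 9.20] -/
theorem weilLineClasses_le_algebraicClasses_of_pairs
    (hA : ∀ j, IsCMTypeRealisation (Ψ j) (A j) (act j) (θ j))
    (h01 : Ψ 1 = CMTypeOps.bar (Ψ 0)) (h23 : Ψ 3 = CMTypeOps.bar (Ψ 2)) :
    weilLineClasses A act 4 ≤ algebraicClasses (⨁ A).X 2 := by
  choose v hv using fun j => exists_eigenbasis (hA j)
  rw [weilLineClasses_eq_iSup_span_monomial (v := v) hA hv]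
  exact iSup_le fun σ => (Submodule.span_singleton_le_iff_mem _ _).2
    (monomial_mem_algebraicClasses_of_pairs hA hv h01 h23 σ)

/-- **Consumer form** (the hypothesis `hW` of `HodgeTheory.mem_algebraicClasses_cmTypedProduct_of_andre1992`
at `p = 2`, alternative (P)): every class in the `K`-Weil-line space of a product of two conjugate pairs is
algebraic — rationality and Hodge type are not even needed. [cite: Deligne1982HodgeCycles, endnote M.12] -/
theorem mem_algebraicClasses_of_mem_weilLineClasses_of_pairs
    (hA : ∀ j, IsCMTypeRealisation (Ψ j) (A j) (act j) (θ j))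
    (h01 : Ψ 1 = CMTypeOps.bar (Ψ 0)) (h23 : Ψ 3 = CMTypeOps.bar (Ψ 2))
    {t : complexBetti (⨁ A).X (2 * 2)} (ht : t ∈ weilLineClasses A act (2 * 2)) :
    t ∈ algebraicClasses (⨁ A).X 2 :=
  weilLineClasses_le_algebraicClasses_of_pairs hA h01 h23 ht

/-! ## Arbitrary position of the two pairs: transport along a permutation of the slots -/

omit [NumberField K] in
/-- The reindexing isomorphism `⨁_k A (ε k) ≅ ⨁ A` intertwines the diagonal actions. [folklore] -/
theorem diagonalAction_reindex (ε : Fin 4 ≃ Fin 4) (a : 𝓞 K) :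
    diagonalAction (A ∘ ε) (fun k => act (ε k)) a ≫ (biproduct.reindex ε A).hom =
      (biproduct.reindex ε A).hom ≫ diagonalAction A act a := by
  apply biproduct.hom_ext'
  intro k
  simp only [diagonalAction, biproduct.reindex_hom, biproduct.ι_map_assoc, biproduct.ι_desc,
    biproduct.ι_desc_assoc]
  exact (biproduct.ι_map (fun j => act j a) (ε k)).symm

omit [NumberField K] in
/-- Pull-back along the reindexing isomorphism maps `K`-Weil-line classes of `⨁ A` to `K`-Weil-line classes
of the reindexed product. [folklore] -/
theorem map_reindex_mem_weilLineClasses (ε : Fin 4 ≃ Fin 4) {d : ℕ} {x : complexBetti (⨁ A).X d}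
    (hx : x ∈ weilLineClasses A act d) :
    complexBetti.map (biproduct.reindex ε A).hom.hom.hom.hom d x ∈
      weilLineClasses (A ∘ ε) (fun k => act (ε k)) d := by
  unfold weilLineClasses at hx ⊢
  induction hx using Submodule.iSup_induction' with
  | mem s x hx =>
    refine Submodule.mem_iSup_of_mem s ((Submodule.mem_iInf _).2 fun a => Module.End.mem_eigenspace_iff.2 ?_)
    have h1 := Module.End.mem_eigenspace_iff.1 ((Submodule.mem_iInf _).1 hx a)
    change complexBetti.map (diagonalAction (A ∘ ε) (fun k => act (ε k)) a).hom.hom.hom d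
      (complexBetti.map (biproduct.reindex ε A).hom.hom.hom.hom d x) = _
    rw [← CategoryTheory.comp_apply, ← complexBetti_map_comp_hom, diagonalAction_reindex,
      complexBetti_map_comp_hom, CategoryTheory.comp_apply]
    change complexBetti.map (biproduct.reindex ε A).hom.hom.hom.hom d
      ((complexBetti.map (diagonalAction A act a).hom.hom.hom d).hom x) = _
    rw [h1, map_smul]
  | zero => rw [map_zero]; exact Submodule.zero_mem _
  | add x y _ _ hx hy => rw [map_add]; exact Submodule.add_mem _ hx hy

/-- **Pair case (P) in arbitrary position**: if the four slots split into two conjugate pairs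
`{ε 0, ε 1}`, `{ε 2, ε 3}` for a permutation `ε` of the slots, every `K`-Weil-line class of `⨁ A` is
algebraic (transport of `weilLineClasses_le_algebraicClasses_of_pairs` along the reindexing isomorphism
`⨁_k A (ε k) ≅ ⨁ A`: pull-backs along homomorphisms of abelian varieties preserve algebraic classes).
[cite: Deligne1982HodgeCycles, §4 (4.4) and endnote M.12] [cite: VoisinHodgeI2002, Thm. 11.30] -/
theorem weilLineClasses_le_algebraicClasses_of_perm
    (hA : ∀ j, IsCMTypeRealisation (Ψ j) (A j) (act j) (θ j)) (ε : Fin 4 ≃ Fin 4)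
    (h01 : Ψ (ε 1) = CMTypeOps.bar (Ψ (ε 0))) (h23 : Ψ (ε 3) = CMTypeOps.bar (Ψ (ε 2))) :
    weilLineClasses A act 4 ≤ algebraicClasses (⨁ A).X 2 := by
  intro x hx
  set e := biproduct.reindex ε A
  have hB : IsSmoothProjective (⨁ A).dim (⨁ A).X := AbelianVariety.isSmoothProjective_holds
  -- on the reindexed product the pairs are in normalised position
  have halg : complexBetti.map e.hom.hom.hom.hom 4 x ∈ algebraicClasses (⨁ (A ∘ ε)).X 2 :=
    weilLineClasses_le_algebraicClasses_of_pairs (A := A ∘ ε) (act := fun k => act (ε k))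
      (θ := fun k => θ (ε k)) (Ψ := fun k => Ψ (ε k)) (fun k => hA (ε k)) h01 h23
      (map_reindex_mem_weilLineClasses ε hx)
  -- pull back along the inverse: `e.inv ≫ e.hom = 𝟙`
  have h := map_mem_algebraicClasses_of_abelianVariety hB (⨁ (A ∘ ε)) e.inv.hom.hom.hom halg
  have hid : complexBetti.map e.inv.hom.hom.hom (2 * 2) (complexBetti.map e.hom.hom.hom.hom 4 x) = x := by
    change complexBetti.map e.inv.hom.hom.hom 4 (complexBetti.map e.hom.hom.hom.hom 4 x) = x
    rw [← CategoryTheory.comp_apply, ← complexBetti_map_comp_hom, e.inv_hom_id]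
    change complexBetti.map (𝟙 (⨁ A).X) 4 x = x
    rw [complexBetti.map_id]
    rfl
  rwa [hid] at h

/-- **Pair case (P) in the shape of `CyclicSextic.sumTwo_pattern`**: slots `0, j₁, j₂, j₃` pairwise distinct
with `Ψ j₁ = Ψ̄ 0` and `Ψ j₃ = Ψ̄ j₂`. [cite: Deligne1982HodgeCycles, §4 (4.4) and endnote M.12] -/
theorem weilLineClasses_le_algebraicClasses_of_pattern
    (hA : ∀ j, IsCMTypeRealisation (Ψ j) (A j) (act j) (θ j)) {j₁ j₂ j₃ : Fin 4}
    (hnd : [(0 : Fin 4), j₁, j₂, j₃].Nodup) (h1 : Ψ j₁ = CMTypeOps.bar (Ψ 0))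
    (h3 : Ψ j₃ = CMTypeOps.bar (Ψ j₂)) :
    weilLineClasses A act 4 ≤ algebraicClasses (⨁ A).X 2 := by
  have hinj : Function.Injective ![(0 : Fin 4), j₁, j₂, j₃] := by
    rw [← List.nodup_ofFn]
    simpa using hnd
  let ε : Fin 4 ≃ Fin 4 := Equiv.ofBijective _ (Finite.injective_iff_bijective.1 hinj)
  exact weilLineClasses_le_algebraicClasses_of_perm hA ε (by simpa [ε] using h1) (by simpa [ε] using h3)

/-- **Consumer form in arbitrary position** (hypothesis `hW` of
`HodgeTheory.mem_algebraicClasses_cmTypedProduct_of_andre1992` at `p = 2`, alternative (P) of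
`CyclicSextic.sumTwo_pattern`). [cite: Deligne1982HodgeCycles, endnote M.12] -/
theorem mem_algebraicClasses_of_mem_weilLineClasses_of_pattern
    (hA : ∀ j, IsCMTypeRealisation (Ψ j) (A j) (act j) (θ j)) {j₁ j₂ j₃ : Fin 4}
    (hnd : [(0 : Fin 4), j₁, j₂, j₃].Nodup) (h1 : Ψ j₁ = CMTypeOps.bar (Ψ 0))
    (h3 : Ψ j₃ = CMTypeOps.bar (Ψ j₂)) {t : complexBetti (⨁ A).X (2 * 2)}
    (ht : t ∈ weilLineClasses A act (2 * 2)) : t ∈ algebraicClasses (⨁ A).X 2 :=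
  weilLineClasses_le_algebraicClasses_of_pattern hA hnd h1 h3 ht

/-- The same with the degree spelled `2 * 2` (the shape of the cell's model junction
`Model.weilFaceAlgebraic_of_weilLineClasses_le` and of André's `hW` at `p = 2`). [cite: Deligne1982HodgeCycles, endnote M.12] -/
theorem weilLineClasses_two_mul_two_le_algebraicClasses_of_pattern
    (hA : ∀ j, IsCMTypeRealisation (Ψ j) (A j) (act j) (θ j)) {j₁ j₂ j₃ : Fin 4}
    (hnd : [(0 : Fin 4), j₁, j₂, j₃].Nodup) (h1 : Ψ j₁ = CMTypeOps.bar (Ψ 0))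
    (h3 : Ψ j₃ = CMTypeOps.bar (Ψ j₂)) :
    weilLineClasses A act (2 * 2) ≤ algebraicClasses (⨁ A).X 2 :=
  weilLineClasses_le_algebraicClasses_of_pattern hA hnd h1 h3

end FourSlots

end Summit.HodgeConjecture.CorCM.WeilLineMonomial

end
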